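import Summits.Ventures.LatticeQCDFlow.Scoring.TorusAreaLaw2D
import HarnessLib

/-!
# The exact non-abelian area law in two dimensions, V-c: `|⟨W_{R×T}⟩_{L,β}| ≤ P^{RT} + K q^{2RT}` on the torus, uniformly in `L`

HONEST FRAMING: exact (Metropolis-corrected) sampling algorithms for lattice gauge theory;
figures of merit are autocorrelation/cost numbers at stated couplings and volumes; no
continuum-physics claim.

Venture `LatticeQCDFlow` (cell pub-lqcd), sub-topic `Scoring`; FANOUT row 5 (`s0-sun-a`), GEN-18.
NEW WORK of the cell (placement rule).  THE ONE-BAD-SET EXPANSION FOR THE WILSON LOOP ON THE TORUS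
`(ℤ/L)²` (theory-2's `wilsonMeasure`, every compact second-countable gauge group, continuous `ρ`, any real `β`):
write the one-plaquette weight as `w = c₀ + v` (`c₀ = e^{−|β|(N+B)} ≤ w ≤ s₁ = e^{|β|(N+B)}`, `B = sup |Re tr ρ|`) on
the `L² − RT` plaquettes outside the loop's region and expand; every term but the full one has a puncture
and is EXACT (`TorusAreaLaw2D` §2 / `NonabelianAreaLaw2DTorusPeel`); the full term costs one factor `s₁`.

* `abs_div_le_of_expansion` — the arithmetic of the bound;
* **`abs_ratio_loop_le`**, **`abs_wilsonExpectation_loop_le`** — for a scalar one-plaquette matrix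
  `∫ ρ(g) w(g) dg = c·1` and every `L`, corner `x`, `1 ≤ R, T`, `2R ≤ L`, `2T ≤ L`:
  `|⟨W_{R×T}⟩_{L,β}| ≤ (‖c‖/m)^{RT} + (B s₁/(N c₀)) · (1 − c₀/m)^{2RT}`, `m = ∫ w` — constants INDEPENDENT of
  the volume and of the position (`L² − RT − 1 ≥ 2RT`): the torus Wilson loop of two-dimensional lattice
  Yang–Mills decays with the AREA at every coupling, uniformly in the volume; part V-d turns this into
  `HasAreaLaw 2 ρ β` (Literature `ConstructiveQFTWave0`, S12) for `U(N)` and `SU(N)`.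

No `def`, nothing cited as a fact, 0 sorry.
-/

noncomputable section

open MeasureTheory Function Finset
open Literature.MathematicalPhysics.QuantumFieldTheory
open Literature.MathematicalPhysics.QuantumLattice
open Summit.Ventures.LatticeQCDFlow.Theory2.Lattice
open Summit.Ventures.LatticeQCDFlow.Theory2.Lattice.TwoDim

namespace Summit.Ventures.LatticeQCDFlow.Scoring

variable {L : ℕ} [NeZero L] {G : Type*} [Group G] [TopologicalSpace G] [IsTopologicalGroup G]
  [CompactSpace G] [SecondCountableTopology G] [MeasurableSpace G] [BorelSpace G] {N : ℕ}
  (ρ : G →* Matrix (Fin N) (Fin N) ℂ)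

/-! ## §3. The one-bad-set expansion: an area-law bound uniform in the volume -/

section Bound

omit [NeZero L] [Group G] [TopologicalSpace G] [IsTopologicalGroup G] [CompactSpace G]
  [SecondCountableTopology G] [MeasurableSpace G] [BorelSpace G] ρ in
/-- The arithmetic of the bound: `|Num| ≤ a^k S + E y^{n−1} m^k`, `m^k S ≤ Den`, `S = m^n − y^n`,
`y = m − c₀`, `0 < c₀ ≤ m`, `2k + 1 ≤ n` give `|Num/Den| ≤ (a/m)^k + (E/c₀)(1 − c₀/m)^{2k}`. -/
theorem abs_div_le_of_expansion {Num Den a E m c₀ y S : ℝ} {k n : ℕ} (ha : 0 ≤ a) (hE : 0 ≤ E)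
    (hc₀ : 0 < c₀) (hc₀m : c₀ ≤ m) (hy : y = m - c₀) (hS : S = m ^ n - y ^ n) (hn : 2 * k + 1 ≤ n)
    (hNum : |Num| ≤ a ^ k * S + E * y ^ (n - 1) * m ^ k) (hDen : m ^ k * S ≤ Den) :
    |Num / Den| ≤ (a / m) ^ k + E / c₀ * (1 - c₀ / m) ^ (2 * k) := by
  have hm : 0 < m := lt_of_lt_of_le hc₀ hc₀m
  have hy0 : 0 ≤ y := by rw [hy]; linarith
  have hym : y ≤ m := by rw [hy]; linarith
  obtain ⟨n', rfl⟩ : ∃ n', n = n' + 1 := ⟨n - 1, by omega⟩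
  simp only [Nat.add_sub_cancel] at hNum
  -- `S ≥ c₀ m^{n-1} > 0`
  have hSge : c₀ * m ^ n' ≤ S := by
    have h1 : y ^ n' ≤ m ^ n' := pow_le_pow_left₀ hy0 hym n'
    have h2 : y ^ (n' + 1) ≤ y * m ^ n' := by
      rw [pow_succ']
      exact mul_le_mul_of_nonneg_left h1 hy0
    rw [hS, pow_succ' m n']
    rw [hy] at h2 ⊢
    nlinarith [h2, pow_nonneg hm.le n']
  have hSpos : 0 < S := lt_of_lt_of_le (by positivity) hSge
  have hDenpos : 0 < Den := lt_of_lt_of_le (by positivity) hDen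
  have hq : y / m = 1 - c₀ / m := by rw [hy]; field_simp
  have hq1 : y / m ≤ 1 := by rw [div_le_one hm]; exact hym
  have hq0 : 0 ≤ y / m := div_nonneg hy0 hm.le
  have hpow : (y / m) ^ n' ≤ (y / m) ^ (2 * k) := pow_le_pow_of_le_one hq0 hq1 (by omega)
  have hKnonneg : 0 ≤ E / c₀ * (1 - c₀ / m) ^ (2 * k) := by
    rw [← hq]; exact mul_nonneg (div_nonneg hE hc₀.le) (pow_nonneg hq0 _)
  -- the bad term against `m^k S`
  have hkey : E * y ^ n' * m ^ k ≤ E / c₀ * (1 - c₀ / m) ^ (2 * k) * (m ^ k * S) := by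
    rw [← hq]
    have e1 : E * y ^ n' * m ^ k = E / c₀ * (y / m) ^ n' * (m ^ k * (c₀ * m ^ n')) := by
      rw [div_pow]
      field_simp
    rw [e1]
    calc E / c₀ * (y / m) ^ n' * (m ^ k * (c₀ * m ^ n'))
        ≤ E / c₀ * (y / m) ^ (2 * k) * (m ^ k * (c₀ * m ^ n')) := by gcongr
      _ ≤ E / c₀ * (y / m) ^ (2 * k) * (m ^ k * S) := by gcongr
  rw [abs_div, abs_of_pos hDenpos, div_le_iff₀ hDenpos]
  calc |Num| ≤ a ^ k * S + E * y ^ n' * m ^ k := hNum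
    _ ≤ (a / m) ^ k * (m ^ k * S) + E / c₀ * (1 - c₀ / m) ^ (2 * k) * (m ^ k * S) := by
        rw [div_pow, ← mul_assoc, div_mul_cancel₀ _ (pow_ne_zero _ hm.ne')]
        linarith [hkey]
    _ ≤ (a / m) ^ k * Den + E / c₀ * (1 - c₀ / m) ^ (2 * k) * Den :=
        add_le_add (mul_le_mul_of_nonneg_left hDen (pow_nonneg (div_nonneg ha hm.le) _))
          (mul_le_mul_of_nonneg_left hDen hKnonneg)
    _ = ((a / m) ^ k + E / c₀ * (1 - c₀ / m) ^ (2 * k)) * Den := by ring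

/-- **THE ONE-BAD-SET EXPANSION FOR THE LOOP** (general weight).  For a continuous class weight `w`
pinched as `0 < c₀ ≤ w ≤ s₁`, a scalar one-plaquette matrix `∫ ρ(g) w(g) dg = c·1`, `|Re tr ρ| ≤ B`, and a
loop `R × T` with corner `x` on `(ℤ/L)²`, `1 ≤ R, T`, `2R ≤ L`, `2T ≤ L`:
`|∫ W ∏_y w(U_y) / ∫ ∏_y w(U_y)| ≤ (‖c‖/∫w)^{RT} + (B s₁/(N c₀)) (1 − c₀/∫w)^{2RT}`. -/
theorem abs_ratio_loop_le [NeZero N] (hρ : Continuous ρ) {B : ℝ} (hB0 : 0 ≤ B)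
    (hB : ∀ g : G, |(ρ g).trace.re| ≤ B) {w : G → ℝ} (hw : Continuous w)
    (hwc : ∀ k g, w (k * g * k⁻¹) = w g) {c₀ s₁ : ℝ} (hc₀ : 0 < c₀) (hwlo : ∀ g, c₀ ≤ w g)
    (hwhi : ∀ g, w g ≤ s₁) {c : ℂ}
    (hM : (Matrix.of fun k l : Fin N => ∫ g, ρ g k l * (w g : ℂ) ∂(haarProbability G)) =
      c • (1 : Matrix (Fin N) (Fin N) ℂ))
    (hL : 2 ≤ L) (x : Site 2 L) {R T : ℕ} (hR1 : 1 ≤ R) (hT1 : 1 ≤ T) (h2R : 2 * R ≤ L) (h2T : 2 * T ≤ L) :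
    |(∫ U, wilsonLoop ρ x 0 1 R T U * ∏ y : Site 2 L, w (plaquetteHolonomy U y 0 1)
        ∂(Measure.pi fun _ : Edge 2 L => haarProbability G)) /
      ∫ U, ∏ y : Site 2 L, w (plaquetteHolonomy U y 0 1) ∂(Measure.pi fun _ : Edge 2 L => haarProbability G)|
      ≤ (‖c‖ / ∫ g, w g ∂(haarProbability G)) ^ (R * T) +
        B / N * s₁ / c₀ * (1 - c₀ / ∫ g, w g ∂(haarProbability G)) ^ (2 * (R * T)) := by
  classical
  -- one-plaquette quantities
  set m : ℝ := ∫ g, w g ∂(haarProbability G) with hm_def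
  have hwi : Integrable w (haarProbability G) := integrable_haarProbability_of_continuous hw
  have hm_lo : c₀ ≤ m := by
    have h : ∫ _g : G, c₀ ∂(haarProbability G) ≤ m := integral_mono (integrable_const c₀) hwi hwlo
    simpa using h
  have hm_pos : 0 < m := lt_of_lt_of_le hc₀ hm_lo
  have hs₁ : 0 ≤ s₁ := (hc₀.le.trans (hwlo 1)).trans (hwhi 1)
  let v : G → ℝ := fun g => w g - c₀
  have hv : Continuous v := hw.sub continuous_const
  have hv0 : ∀ g, 0 ≤ v g := fun g => sub_nonneg.mpr (hwlo g)
  have hv_le : ∀ g, v g ≤ s₁ := fun g => by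
    show w g - c₀ ≤ s₁
    linarith [hwhi g]
  set y : ℝ := ∫ g, v g ∂(haarProbability G) with hy_def
  have hy : y = m - c₀ := by
    show ∫ g, (w g - c₀) ∂(haarProbability G) = m - c₀
    rw [integral_sub hwi (integrable_const c₀)]
    simp [hm_def]
  have hy0 : 0 ≤ y := integral_nonneg hv0
  -- geometry: the region, its complement, cardinalities
  have hRL : R + 1 ≤ L := by omega
  have hTL : T + 1 ≤ L := by omega
  set Reg : Finset (Site 2 L) :=
    (range R ×ˢ range T).image (fun q : ℕ × ℕ => (![x 0 + q.1, x 1 + q.2] : Site 2 L)) with hReg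
  set O : Finset (Site 2 L) := Regᶜ with hO
  have hO_out : ∀ z ∈ O, z ∉ Reg := fun z hz => Finset.mem_compl.mp hz
  have hcardReg : Reg.card = R * T := card_rectSites (x 0) (x 1) (by omega) (by omega)
  have hcardO : O.card = L ^ 2 - R * T := by
    rw [hO, Finset.card_compl, hcardReg, Fintype.card_fun, ZMod.card, Fintype.card_fin]
  have h4 : 4 * (R * T) ≤ L ^ 2 := by nlinarith [Nat.mul_le_mul h2R h2T]
  have hRT1 : 1 ≤ R * T := Nat.one_le_iff_ne_zero.mpr (Nat.mul_ne_zero (by omega) (by omega))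
  have hn : 2 * (R * T) + 1 ≤ O.card := by rw [hcardO]; omega
  obtain ⟨x₁, hx₁⟩ : O.Nonempty := Finset.card_pos.mp (by omega)
  -- the loop at `x = (x 0, x 1)`
  have hx : (![x 0, x 1] : Site 2 L) = x := site_two_eta x
  -- integrals over the product measure
  set π : Measure (GaugeConfig 2 L G) := Measure.pi fun _ : Edge 2 L => haarProbability G with hπ
  have hcw : ∀ s : Finset (Site 2 L), Continuous fun U : GaugeConfig 2 L G =>
      ∏ z ∈ s, w (plaquetteHolonomy U z 0 1) := fun s =>
    continuous_finsetProd _ fun z _ => hw.comp (continuous_config_plaquetteHolonomy z 0 1)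
  have hcv : ∀ s : Finset (Site 2 L), Continuous fun U : GaugeConfig 2 L G =>
      ∏ z ∈ s, v (plaquetteHolonomy U z 0 1) := fun s =>
    continuous_finsetProd _ fun z _ => hv.comp (continuous_config_plaquetteHolonomy z 0 1)
  have hWc : Continuous fun U : GaugeConfig 2 L G => wilsonLoop ρ x 0 1 R T U := by
    unfold wilsonLoop
    exact continuous_const.mul (Complex.continuous_re.comp
      ((hρ.comp (continuous_config_rectangleHolonomy x 0 1 R T)).matrix_trace))
  have hWb : ∀ U : GaugeConfig 2 L G, |wilsonLoop ρ x 0 1 R T U| ≤ B / N := fun U => by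
    unfold wilsonLoop
    rw [abs_mul, abs_inv, Nat.abs_cast, div_eq_inv_mul]
    exact mul_le_mul_of_nonneg_left (hB _) (by positivity)
  -- the integrals indexed by outer subsets
  let I : Finset (Site 2 L) → ℝ := fun t => ∫ U, wilsonLoop ρ x 0 1 R T U *
    ((∏ p ∈ Reg, w (plaquetteHolonomy U p 0 1)) * ∏ z ∈ t, v (plaquetteHolonomy U z 0 1)) ∂π
  let J : Finset (Site 2 L) → ℝ := fun t => ∫ U,
    (∏ p ∈ Reg, w (plaquetteHolonomy U p 0 1)) * ∏ z ∈ t, v (plaquetteHolonomy U z 0 1) ∂π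
  -- exact values off a puncture
  have hI : ∀ t ∈ O.powerset.erase O, I t = y ^ t.card * (c ^ (R * T)).re := by
    intro t ht
    obtain ⟨htO, ht⟩ := Finset.mem_erase.mp ht
    have hsub : t ⊆ O := Finset.mem_powerset.mp ht
    obtain ⟨x₀, hx₀O, hx₀t⟩ := Finset.exists_of_ssubset (Finset.ssubset_iff_subset_ne.mpr ⟨hsub, htO⟩)
    have h := integral_wilsonLoop_mul_prod_punctured ρ hw hwc hv hρ hL hM (x 0) (x 1) hR1 hT1 hRL hTL x₀
      (hO_out x₀ hx₀O) t (fun z hz => hO_out z (hsub hz)) hx₀t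
    rw [hx] at h
    exact h
  have hJ : ∀ t, t ⊆ O → ∀ x₀ ∈ O, x₀ ∉ t → J t = y ^ t.card * m ^ (R * T) := by
    intro t hsub x₀ hx₀O hx₀t
    exact integral_prod_rect_mul_prod_punctured hw hwc hv hL (x 0) (x 1) hRL hTL x₀ (hO_out x₀ hx₀O) t
      (fun z hz => hO_out z (hsub hz)) hx₀t
  have hJ' : ∀ t ∈ O.powerset.erase O, J t = y ^ t.card * m ^ (R * T) := by
    intro t ht
    obtain ⟨htO, ht⟩ := Finset.mem_erase.mp ht
    have hsub : t ⊆ O := Finset.mem_powerset.mp ht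
    obtain ⟨x₀, hx₀O, hx₀t⟩ := Finset.exists_of_ssubset (Finset.ssubset_iff_subset_ne.mpr ⟨hsub, htO⟩)
    exact hJ t hsub x₀ hx₀O hx₀t
  -- the expansion of the two integrals
  have hexpand : ∀ (F : GaugeConfig 2 L G → ℝ), Continuous F →
      ∫ U, F U * ∏ z : Site 2 L, w (plaquetteHolonomy U z 0 1) ∂π =
        ∑ t ∈ O.powerset, c₀ ^ (O \ t).card *
          ∫ U, F U * ((∏ p ∈ Reg, w (plaquetteHolonomy U p 0 1)) * ∏ z ∈ t, v (plaquetteHolonomy U z 0 1)) ∂π := by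
    intro F hF
    have hpt : ∀ U : GaugeConfig 2 L G, F U * ∏ z : Site 2 L, w (plaquetteHolonomy U z 0 1) =
        ∑ t ∈ O.powerset, c₀ ^ (O \ t).card *
          (F U * ((∏ p ∈ Reg, w (plaquetteHolonomy U p 0 1)) * ∏ z ∈ t, v (plaquetteHolonomy U z 0 1))) := by
      intro U
      rw [← Finset.prod_mul_prod_compl Reg]
      have hO' : ∏ z ∈ Regᶜ, w (plaquetteHolonomy U z 0 1) =
          ∑ t ∈ O.powerset, (∏ z ∈ t, v (plaquetteHolonomy U z 0 1)) * c₀ ^ (O \ t).card := by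
        rw [← hO]
        have : ∀ z, w (plaquetteHolonomy U z 0 1) = v (plaquetteHolonomy U z 0 1) + c₀ := fun z => by
          show _ = (w _ - c₀) + c₀; ring
        simp_rw [this, Finset.prod_add, Finset.prod_const]
      rw [hO', Finset.mul_sum, Finset.mul_sum]
      exact Finset.sum_congr rfl fun t _ => by ring
    simp_rw [hpt]
    rw [integral_finsetSum _ fun t _ => ?_]
    · exact Finset.sum_congr rfl fun t _ => integral_const_mul _ _
    · exact (integrable_gaugeConfig_of_continuous (hF.mul ((hcw Reg).mul (hcv t)))).const_mul _
  -- S, and its value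
  set S : ℝ := ∑ t ∈ O.powerset.erase O, c₀ ^ (O \ t).card * y ^ t.card with hS_def
  have hS : S = m ^ O.card - y ^ O.card := by
    have htot : ∑ t ∈ O.powerset, c₀ ^ (O \ t).card * y ^ t.card = m ^ O.card := by
      rw [show m = y + c₀ by rw [hy]; ring, ← Finset.sum_pow_mul_eq_add_pow]
      refine Finset.sum_congr rfl fun t ht => ?_
      rw [Finset.card_sdiff_of_subset (Finset.mem_powerset.mp ht), mul_comm]
    rw [← htot, ← Finset.sum_erase_add _ _ (Finset.mem_powerset_self O), Finset.sdiff_self,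
      Finset.card_empty, pow_zero, one_mul]
    ring
  -- numerator and denominator
  have hNum : ∫ U, wilsonLoop ρ x 0 1 R T U * ∏ z : Site 2 L, w (plaquetteHolonomy U z 0 1) ∂π =
      I O + (c ^ (R * T)).re * S := by
    rw [hexpand _ hWc, ← Finset.sum_erase_add _ _ (Finset.mem_powerset_self O), Finset.sdiff_self,
      Finset.card_empty, pow_zero, one_mul, add_comm, hS_def, Finset.mul_sum]
    congr 1
    refine Finset.sum_congr rfl fun t ht => ?_
    show c₀ ^ (O \ t).card * I t = _
    rw [hI t ht]
    ring
  have hDen : ∫ U, ∏ z : Site 2 L, w (plaquetteHolonomy U z 0 1) ∂π = J O + m ^ (R * T) * S := by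
    have h := hexpand (fun _ => 1) continuous_const
    simp only [one_mul] at h
    rw [h, ← Finset.sum_erase_add _ _ (Finset.mem_powerset_self O), Finset.sdiff_self, Finset.card_empty,
      pow_zero, one_mul, add_comm, hS_def, Finset.mul_sum]
    congr 1
    refine Finset.sum_congr rfl fun t ht => ?_
    show c₀ ^ (O \ t).card * J t = _
    rw [hJ' t ht]
    ring
  -- the bad terms
  have hJO_nonneg : 0 ≤ J O := integral_nonneg fun U => mul_nonneg
    (Finset.prod_nonneg fun p _ => hc₀.le.trans (hwlo _)) (Finset.prod_nonneg fun z _ => hv0 _)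
  have hJO_le : J O ≤ s₁ * (y ^ (O.card - 1) * m ^ (R * T)) := by
    have h1 : J O ≤ s₁ * J (O.erase x₁) := by
      show ∫ U, _ ∂π ≤ s₁ * ∫ U, _ ∂π
      rw [← integral_const_mul]
      refine integral_mono_of_nonneg (ae_of_all _ fun U => mul_nonneg
        (Finset.prod_nonneg fun p _ => hc₀.le.trans (hwlo _)) (Finset.prod_nonneg fun z _ => hv0 _))
        ((integrable_gaugeConfig_of_continuous ((hcw Reg).mul (hcv _))).const_mul _)
        (ae_of_all _ fun U => ?_)
      show (∏ p ∈ Reg, w (plaquetteHolonomy U p 0 1)) * ∏ z ∈ O, v (plaquetteHolonomy U z 0 1) ≤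
        s₁ * ((∏ p ∈ Reg, w (plaquetteHolonomy U p 0 1)) * ∏ z ∈ O.erase x₁, v (plaquetteHolonomy U z 0 1))
      rw [← Finset.mul_prod_erase O _ hx₁]
      have hP : 0 ≤ ∏ p ∈ Reg, w (plaquetteHolonomy U p 0 1) :=
        Finset.prod_nonneg fun p _ => hc₀.le.trans (hwlo _)
      have hQ : 0 ≤ ∏ z ∈ O.erase x₁, v (plaquetteHolonomy U z 0 1) := Finset.prod_nonneg fun z _ => hv0 _
      nlinarith [hv_le (plaquetteHolonomy U x₁ 0 1), mul_nonneg hP hQ]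
    rw [hJ (O.erase x₁) (Finset.erase_subset x₁ O) x₁ hx₁ (Finset.notMem_erase x₁ O),
      Finset.card_erase_of_mem hx₁] at h1
    exact h1
  have hIO_le : |I O| ≤ B / N * s₁ * y ^ (O.card - 1) * m ^ (R * T) := by
    have h1 : |I O| ≤ B / N * J O := by
      show |∫ U, _ ∂π| ≤ B / N * ∫ U, _ ∂π
      rw [← integral_const_mul]
      refine (abs_integral_le_integral_abs).trans (integral_mono_of_nonneg (ae_of_all _ fun U => abs_nonneg _)
        ((integrable_gaugeConfig_of_continuous ((hcw Reg).mul (hcv _))).const_mul _)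
        (ae_of_all _ fun U => ?_))
      show |wilsonLoop ρ x 0 1 R T U * _| ≤ B / N * _
      rw [abs_mul, abs_of_nonneg (mul_nonneg (Finset.prod_nonneg fun p _ => hc₀.le.trans (hwlo _))
        (Finset.prod_nonneg fun z _ => hv0 _))]
      exact mul_le_mul_of_nonneg_right (hWb U) (mul_nonneg
        (Finset.prod_nonneg fun p _ => hc₀.le.trans (hwlo _)) (Finset.prod_nonneg fun z _ => hv0 _))
    calc |I O| ≤ B / N * J O := h1
      _ ≤ B / N * (s₁ * (y ^ (O.card - 1) * m ^ (R * T))) :=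
          mul_le_mul_of_nonneg_left hJO_le (div_nonneg hB0 (Nat.cast_nonneg N))
      _ = _ := by ring
  -- conclude with the arithmetic lemma
  rw [hNum, hDen]
  have hSnn : 0 ≤ S := by
    rw [hS, hy]
    exact sub_nonneg.mpr (pow_le_pow_left₀ (by linarith) (by linarith) _)
  refine abs_div_le_of_expansion (norm_nonneg c) (by positivity) hc₀ hm_lo hy hS hn ?_ ?_
  · calc |I O + (c ^ (R * T)).re * S| ≤ |I O| + |(c ^ (R * T)).re * S| := abs_add_le _ _
      _ ≤ B / N * s₁ * y ^ (O.card - 1) * m ^ (R * T) + ‖c‖ ^ (R * T) * S := by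
          refine add_le_add hIO_le ?_
          rw [abs_mul, abs_of_nonneg hSnn, ← norm_pow]
          exact mul_le_mul_of_nonneg_right (Complex.abs_re_le_norm _) hSnn
      _ = ‖c‖ ^ (R * T) * S + B / N * s₁ * y ^ (O.card - 1) * m ^ (R * T) := by ring
  · linarith

/-- **THE TORUS WILSON LOOP OBEYS AN AREA-LAW BOUND UNIFORM IN THE VOLUME** (every compact gauge group,
continuous representation `ρ` with scalar one-plaquette matrix `c·1` for the Wilson weight, any real `β`):
with `B = sup |Re tr ρ|`, `c₀ = e^{−|β|(N+B)}`, `s₁ = e^{|β|(N+B)}`, `m = ∫ e^{−β(N − Re tr ρ)} dHaar`,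
for every `L`, every corner `x` and every `R × T` loop with `1 ≤ R, T`, `2R ≤ L`, `2T ≤ L`:
`|⟨W_{R×T}⟩_{L,β}| ≤ (‖c‖/m)^{RT} + (B s₁/(N c₀)) (1 − c₀/m)^{2RT}`. -/
theorem abs_wilsonExpectation_loop_le [NeZero N] (hρ : Continuous ρ) (β : ℝ) {B : ℝ} (hB0 : 0 ≤ B)
    (hB : ∀ g : G, |(ρ g).trace.re| ≤ B) {c : ℂ}
    (hM : (Matrix.of fun k l : Fin N => ∫ g, ρ g k l *
      (Real.exp (-(β * ((N : ℝ) - (ρ g).trace.re))) : ℂ) ∂(haarProbability G)) =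
        c • (1 : Matrix (Fin N) (Fin N) ℂ))
    (hL : 2 ≤ L) (x : Site 2 L) {R T : ℕ} (hR1 : 1 ≤ R) (hT1 : 1 ≤ T) (h2R : 2 * R ≤ L) (h2T : 2 * T ≤ L) :
    |wilsonExpectation ρ β (wilsonLoop ρ x 0 1 R T)| ≤
      (‖c‖ / ∫ g, Real.exp (-(β * ((N : ℝ) - (ρ g).trace.re))) ∂(haarProbability G)) ^ (R * T) +
        B / N * Real.exp (|β| * (N + B)) / Real.exp (-(|β| * (N + B))) *
          (1 - Real.exp (-(|β| * (N + B))) /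
            ∫ g, Real.exp (-(β * ((N : ℝ) - (ρ g).trace.re))) ∂(haarProbability G)) ^ (2 * (R * T)) := by
  have hw : Continuous fun g : G => Real.exp (-(β * ((N : ℝ) - (ρ g).trace.re))) := by
    have := Complex.continuous_re.comp hρ.matrix_trace
    fun_prop
  have hwc : ∀ k g : G, Real.exp (-(β * ((N : ℝ) - (ρ (k * g * k⁻¹)).trace.re))) =
      Real.exp (-(β * ((N : ℝ) - (ρ g).trace.re))) := fun k g => by
    rw [map_mul, map_mul, Matrix.trace_mul_cycle, ← map_mul, inv_mul_cancel, map_one, one_mul]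
  have hbound : ∀ g : G, |β * ((N : ℝ) - (ρ g).trace.re)| ≤ |β| * (N + B) := fun g => by
    rw [abs_mul]
    refine mul_le_mul_of_nonneg_left ?_ (abs_nonneg β)
    have h1 := hB g
    have h2 : |((N : ℝ) - (ρ g).trace.re)| ≤ |(N : ℝ)| + |(ρ g).trace.re| := abs_sub _ _
    rw [Nat.abs_cast] at h2
    linarith
  have hwlo : ∀ g : G, Real.exp (-(|β| * (N + B))) ≤ Real.exp (-(β * ((N : ℝ) - (ρ g).trace.re))) :=
    fun g => Real.exp_le_exp.mpr (by linarith [(abs_le.mp (hbound g)).2])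
  have hwhi : ∀ g : G, Real.exp (-(β * ((N : ℝ) - (ρ g).trace.re))) ≤ Real.exp (|β| * (N + B)) :=
    fun g => Real.exp_le_exp.mpr (by linarith [(abs_le.mp (hbound g)).1])
  rw [wilsonExpectation_two_eq_div ρ hρ β]
  have h := abs_ratio_loop_le ρ hρ hB0 hB hw hwc (Real.exp_pos _) hwlo hwhi hM hL x hR1 hT1 h2R h2T
  simpa only [div_eq_mul_inv, mul_assoc] using h

end Bound

end Summit.Ventures.LatticeQCDFlow.Scoring
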